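import Literature.MathematicalPhysics.QuantumLattice.HeisenbergOrderNeelProofs
import HarnessLib

/-!
# Kennedy–Lieb–Shastry / Dyson–Lieb–Simon: Néel order in the ground state — assembly

Trunk T-QLATTICE; sibling proof file of `HeisenbergOrder.lean` / `HeisenbergOrderNeelProofs.lean`
(named fact `kennedy_lieb_shastry_ground`, item
`provefact-Literature.MathematicalPhysics.QuantumLa-0a1fdca558`). No statement is introduced or
changed; no named fact is introduced. This file proves:

* `kls_heis_ineq4` — Kennedy–Lieb–Shastry, J. Stat. Phys. 53 (1988), inequality (4) in finite
  volume: on the even torus of side `L = 2k ≥ 4`, the `T = 0` infrared bound (A) at the momenta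
  `q ≠ Q` (`ĝ_q² E_{q-Q} ≤ (-ε/2) E_q`, KLS eq. (1) with `e₀ = -3dε`) and the sum rule (C) give
  `-ε ≤ |Λ|⁻¹ ĝ_Q + (-ε/2)^{1/2} R_L(d)`, `R_L(d) = klsRiemannSum d L`;
* `heis_neelOrder_of_infraredBound` — with the Néel bound (N) `-ε ≥ S²/3` and an eventual bound
  `R_L(d) ≤ ρ < 2S/√6`, the order parameter `3|Λ|⁻¹ĝ_Q` of `HeisenbergOrder.lean` is eventually
  `≥ 3u₀(2u₀ - ρ) > 0`, `u₀ = S/√6` (KLS p. 1022: "This contradiction shows there must be Néel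
  order"), hence `HasStaggeredEvenTorusLRO`;
* `kennedy_lieb_shastry_ground_of_infraredBound` — **the reduction of `kennedy_lieb_shastry_ground`
  to (A) and to the numerical input `limsup_L R_L(3) < 1/√6`** (needed only for `d = 3`, `S = ½`;
  for `S ≥ 1` the tree's `klsRiemannSum_eventually_le`, `limsup R_L(d) ≤ 0.69 < 2/√6`, is used).

## References

* [KLS1988JSP] T. Kennedy, E. H. Lieb, B. S. Shastry, J. Stat. Phys. 53 (1988) 1019–1030,
  pp. 1021–1022, eqs. (1)–(4).
* [DysonLiebSimon1978] F. J. Dyson, E. H. Lieb, B. Simon, J. Stat. Phys. 18 (1978) 335–383, §1.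
-/

noncomputable section

open Filter Topology Matrix Finset
open Literature.MathematicalPhysics.QuantumLattice Literature.Probability.LatticeModels

namespace Literature.MathematicalPhysics.QuantumLattice

variable {d : ℕ}

/-! ### KLS inequality (4) in finite volume -/

/-- The pointwise step of (4): if `0 ≤ g`, `g² E' ≤ s E` with `E' > 0`, `s ≥ 0`, then
`g · (C/d) ≥ -√s · [E/E']^{1/2} {-C/d}₊`. [Kennedy–Lieb–Shastry 1988, from (1), (3) to (4)]
[folklore] -/
theorem kls_heis_pointwise {g E' E C dd s : ℝ} (hg : 0 ≤ g) (hE' : 0 < E') (hdd : 0 < dd)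
    (hs : 0 ≤ s) (hA : g ^ 2 * E' ≤ s * E) :
    -(Real.sqrt s * (Real.sqrt (E / E') * max (-C / dd) 0)) ≤ g * (C / dd) := by
  rcases le_or_gt 0 C with hC | hC
  · have h1 : 0 ≤ g * (C / dd) := mul_nonneg hg (div_nonneg hC hdd.le)
    have h2 : 0 ≤ Real.sqrt s * (Real.sqrt (E / E') * max (-C / dd) 0) := by positivity
    linarith
  · have hCd : 0 < -C / dd := div_pos (by linarith) hdd
    rw [max_eq_left hCd.le]
    -- `g ≤ √s √(E / E')`
    have h3 : g ^ 2 ≤ s * (E / E') := by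
      rw [mul_div_assoc', le_div_iff₀ hE']
      exact hA
    have h4 : g ≤ Real.sqrt s * Real.sqrt (E / E') := by
      rw [← Real.sqrt_mul hs]
      exact Real.le_sqrt_of_sq_le h3
    have h5 : g * (-C / dd) ≤ Real.sqrt s * Real.sqrt (E / E') * (-C / dd) :=
      mul_le_mul_of_nonneg_right h4 hCd.le
    have h6 : g * (C / dd) = -(g * (-C / dd)) := by ring
    have h7 : Real.sqrt s * (Real.sqrt (E / E') * (-C / dd)) =
        Real.sqrt s * Real.sqrt (E / E') * (-C / dd) := by ring
    rw [h6, h7, neg_le_neg_iff]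
    exact h5

/-- Reindexing the punctured momentum sum by the shift `p = q - Q`:
`Σ_{q ≠ Q} F(q - Q) = Σ_{p ≠ 0} F(p)`. [folklore] -/
theorem sum_erase_neelIndex_shift (k : ℕ) [NeZero (2 * k)] (F : TorusSite d (2 * k) → ℝ) :
    ∑ q ∈ (univ : Finset (TorusSite d (2 * k))).erase (neelIndex (2 * k)), F (q - neelIndex (2 * k)) =
      ∑ p ∈ (univ : Finset (TorusSite d (2 * k))).erase 0, F p := by
  refine sum_equiv (Equiv.subRight (neelIndex (2 * k) : TorusSite d (2 * k))) ?_ ?_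
  · intro q
    simp only [mem_erase, mem_univ, and_true, Equiv.subRight_apply, ne_eq, sub_eq_zero]
  · intro q _
    rfl

/-- **Kennedy–Lieb–Shastry's inequality (4) in finite volume.** On the even torus of side
`L = 2k ≥ 4`, `d ≥ 1`: if the `T = 0` infrared bound holds at every `q ≠ Q` in the form
`0 ≤ ĝ_q`, `ĝ_q² E_{q-Q} ≤ (-ε/2) E_q` (KLS eq. (1), `f_q² = e₀E_q/(6dE_{q-Q})`, `e₀ = -3dε`), then
`-ε ≤ |Λ|⁻¹ ĝ_Q + (-ε/2)^{1/2} R_L(d)` with the punctured Riemann sum `R_L(d) = klsRiemannSum d L`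
of the KLS integrand: split the sum rule (C) at `q = Q` (`Σᵢ cos Qᵢ = -d`), bound every other
term below by the infrared bound, and substitute `q = p + Q`.
[Kennedy–Lieb–Shastry 1988, eqs. (3)–(4)] [cite: KLS1988JSP, eqs. (3)–(4)] -/
theorem kls_heis_ineq4 (hd : 1 ≤ d) {n k : ℕ} (hk : 2 ≤ k)
    (hA : ∀ q : TorusSite d (2 * k), q ≠ neelIndex (2 * k) →
      0 ≤ heisStructureFactor 0 (2 * k) n q ∧
        heisStructureFactor 0 (2 * k) n q ^ 2 *
            dispersion (latticeMomentum (2 * k) (q - neelIndex (2 * k))) ≤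
          (-heisBondCorr (d := d) 0 (2 * k) n / 2) * dispersion (latticeMomentum (2 * k) q)) :
    -heisBondCorr (d := d) 0 (2 * k) n ≤
      heisStructureFactor 0 (2 * k) n (neelIndex (2 * k) : TorusSite d (2 * k)) /
          ((2 * k : ℕ) : ℝ) ^ d +
        Real.sqrt (-heisBondCorr (d := d) 0 (2 * k) n / 2) * klsRiemannSum d (2 * k) := by
  haveI : NeZero (2 * k) := ⟨by omega⟩
  have hd0 : (0 : ℝ) < d := by exact_mod_cast (show 0 < d by omega)
  have h2k : (0 : ℝ) < ((2 * k : ℕ) : ℝ) := by exact_mod_cast (show 0 < 2 * k by omega)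
  have hL : (0 : ℝ) < ((2 * k : ℕ) : ℝ) ^ d := pow_pos h2k d
  set Q : TorusSite d (2 * k) := neelIndex (2 * k) with hQ
  set ε := heisBondCorr (d := d) 0 (2 * k) n with hε
  set s := -ε / 2 with hs_def
  -- `s ≥ 0` from the Néel bound
  have hN := heisBondCorr_le hd n k hk
  have hs : 0 ≤ s := by
    rw [hs_def]
    have : 0 ≤ ((n : ℝ) / 2) ^ 2 / 3 := by positivity
    linarith
  -- the sum rule split at `Q`
  have hC := heis_sumRule_split hd 0 k n
  rw [← hε, ← hQ] at hC
  -- termwise lower bound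
  have hterm : ∀ q ∈ (univ : Finset (TorusSite d (2 * k))).erase Q,
      -(Real.sqrt s * klsIntegrand d (latticeMomentum (2 * k) (q - Q))) ≤
        heisStructureFactor 0 (2 * k) n q * (torusCosSum (2 * k) q / d) := by
    intro q hq
    have hqQ : q ≠ Q := (mem_erase.1 hq).1
    obtain ⟨hg, hAq⟩ := hA q hqQ
    have hE' : 0 < dispersion (latticeMomentum (2 * k) (q - Q)) :=
      dispersion_latticeMomentum_pos (sub_ne_zero.2 hqQ)
    rw [hQ, klsIntegrand_latticeMomentum_sub_neelIndex k q]
    rw [hQ, dispersion_latticeMomentum_sub_neelIndex k q] at hE' hAq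
    exact kls_heis_pointwise hg hE' hd0 hs hAq
  have hsum : -(Real.sqrt s * (((2 * k : ℕ) : ℝ) ^ d * klsRiemannSum d (2 * k))) ≤
      ∑ q ∈ (univ : Finset (TorusSite d (2 * k))).erase Q,
        heisStructureFactor 0 (2 * k) n q * (torusCosSum (2 * k) q / d) := by
    have h := sum_le_sum hterm
    rw [sum_neg_distrib, ← mul_sum, hQ, sum_erase_neelIndex_shift k
      (fun p => klsIntegrand d (latticeMomentum (2 * k) p)), ← hQ] at h
    rw [klsRiemannSum_of_neZero, mul_div_cancel₀ _ hL.ne']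
    exact h
  -- assemble: `ε L^d = -ĝ_Q + Σ ≥ -ĝ_Q - √s L^d R`
  have hkey : -ε * ((2 * k : ℕ) : ℝ) ^ d ≤ heisStructureFactor 0 (2 * k) n Q +
      Real.sqrt s * klsRiemannSum d (2 * k) * ((2 * k : ℕ) : ℝ) ^ d := by
    have : ε * ((2 * k : ℕ) : ℝ) ^ d ≥ -heisStructureFactor 0 (2 * k) n Q -
        Real.sqrt s * (((2 * k : ℕ) : ℝ) ^ d * klsRiemannSum d (2 * k)) := by
      rw [hC]; linarith
    nlinarith [this]
  rw [div_add' _ _ _ hL.ne', le_div_iff₀ hL]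
  linarith [hkey]

/-! ### Néel order from the infrared bound and a bound on the Riemann sums -/

/-- `(S/√6)² = (S²/3)/2` and `S/√6 > 0`: the constant `u₀` of the assembly. [folklore] -/
theorem neel_u0_sq (n : ℕ) :
    ((n : ℝ) / 2 / Real.sqrt 6) ^ 2 = ((n : ℝ) / 2) ^ 2 / 3 / 2 := by
  rw [div_pow, Real.sq_sqrt (by norm_num : (0 : ℝ) ≤ 6)]
  ring

/-- **Néel order from (A) and an eventual bound on the Riemann sums** (Kennedy–Lieb–Shastry's
contradiction argument, made quantitative in finite volume). For `d ≥ 2`, spin `S = n/2 ≥ ½`: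
if the `T = 0` infrared bound (A) holds on all even tori of side `2k ≥ 4` and
`R_L(d) ≤ ρ < 2S/√6 = n/√6` for all large `L`, then for every `J > 0` the ground states of
`J Σ 𝐒_x·𝐒_y` have Néel long-range order along even tori: with `s = -ε ≥ S²/3` (N),
`u = (s/2)^{1/2} ≥ u₀ = S/√6` and (4) `2u² ≤ |Λ|⁻¹ĝ_Q + uρ`, the order parameter is
`3|Λ|⁻¹ĝ_Q ≥ 3(2u² - ρu) ≥ 3u₀(2u₀ - ρ) > 0` (`t ↦ 2t² - ρt` increases on `t ≥ ρ/4`).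
[Kennedy–Lieb–Shastry 1988, p. 1022 ("Thus, (4) implies that `e₀ ≤ 0.550`. However, taking the
Néel state as a variational state shows that `-e₀` is less than `-3/4` … there must be Néel
order"); Dyson–Lieb–Simon 1978, §1] [cite: KLS1988JSP, p. 1022] -/
theorem heis_neelOrder_of_infraredBound (hd : 2 ≤ d) {n : ℕ} (hn : 1 ≤ n)
    (hA : ∀ k : ℕ, 2 ≤ k → ∀ q : TorusSite d (2 * k), q ≠ neelIndex (2 * k) →
      0 ≤ heisStructureFactor 0 (2 * k) n q ∧
        heisStructureFactor 0 (2 * k) n q ^ 2 *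
            dispersion (latticeMomentum (2 * k) (q - neelIndex (2 * k))) ≤
          (-heisBondCorr (d := d) 0 (2 * k) n / 2) * dispersion (latticeMomentum (2 * k) q))
    (hρ : ∃ ρ : ℝ, ρ < n / Real.sqrt 6 ∧ ∀ᶠ L : ℕ in atTop, klsRiemannSum d L ≤ ρ)
    {J : ℝ} (hJ : 0 < J) :
    HasStaggeredEvenTorusLRO (fun L x y => groundStateSpinCorrTorus (d := d) L n J x y) := by
  rw [hasStaggeredEvenTorusLRO_iff_holds]
  obtain ⟨ρ, hρlt, hρev⟩ := hρ
  have hd1 : 1 ≤ d := by omega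
  -- the constants
  set u₀ : ℝ := (n : ℝ) / 2 / Real.sqrt 6 with hu₀_def
  have h6 : (0 : ℝ) < Real.sqrt 6 := Real.sqrt_pos.2 (by norm_num)
  have hn1 : (1 : ℝ) ≤ n := by exact_mod_cast hn
  have hu₀pos : 0 < u₀ := by positivity
  have hu₀sq : u₀ ^ 2 = ((n : ℝ) / 2) ^ 2 / 3 / 2 := neel_u0_sq n
  have h2u₀ : 2 * u₀ = n / Real.sqrt 6 := by rw [hu₀_def]; ring
  have hρ2 : ρ < 2 * u₀ := by rwa [h2u₀]
  set c : ℝ := 3 * (u₀ * (2 * u₀ - ρ)) with hc_def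
  have hc : 0 < c := by
    have : 0 < 2 * u₀ - ρ := by linarith
    positivity
  -- eventually `R_{2k+2} ≤ ρ`
  have h2k : Tendsto (fun k : ℕ => 2 * k + 2) atTop atTop :=
    tendsto_atTop_atTop.2 fun b => ⟨b, fun k hk => by omega⟩
  have hRk : ∀ᶠ k : ℕ in atTop, klsRiemannSum d (2 * k + 2) ≤ ρ := h2k.eventually hρev
  -- eventually the order parameter is `≥ c`
  have hev : ∀ᶠ k : ℕ in atTop, c ≤
      (∑ x : TorusSite d (2 * k + 2), ∑ y : TorusSite d (2 * k + 2),
          (-1 : ℝ) ^ (∑ i, (x i).val) * (-1) ^ (∑ i, (y i).val) *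
            groundStateSpinCorrTorus (2 * k + 2) n J x y) / ((2 * k + 2 : ℕ) : ℝ) ^ (2 * d) := by
    filter_upwards [hRk, eventually_ge_atTop 1] with k hRk' hk1
    -- work on the torus of side `2K`, `K = k + 1 ≥ 2`
    haveI : NeZero (2 * (k + 1)) := ⟨by omega⟩
    have hK : 2 ≤ k + 1 := by omega
    have hsum := neelSum_eq (d := d) n (k + 1) hJ
    have h4 := kls_heis_ineq4 hd1 hK (hA (k + 1) hK)
    have hN := heisBondCorr_le hd1 n (k + 1) hK
    have hR0 : 0 ≤ klsRiemannSum d (2 * (k + 1)) := klsRiemannSum_nonneg _ _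
    have hRρ : klsRiemannSum d (2 * (k + 1)) ≤ ρ := hRk'
    set s : ℝ := -heisBondCorr (d := d) 0 (2 * (k + 1)) n with hs_def
    set m : ℝ := heisStructureFactor 0 (2 * (k + 1)) n
      (neelIndex (2 * (k + 1)) : TorusSite d (2 * (k + 1))) / ((2 * (k + 1) : ℕ) : ℝ) ^ d with hm_def
    set R : ℝ := klsRiemannSum d (2 * (k + 1)) with hR_def
    have hs0 : u₀ ^ 2 ≤ s / 2 := by rw [hu₀sq]; linarith
    set u : ℝ := Real.sqrt (s / 2) with hu_def
    have hu0 : 0 ≤ u := Real.sqrt_nonneg _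
    have hsu : s = 2 * u ^ 2 := by
      rw [hu_def, Real.sq_sqrt (le_trans (sq_nonneg u₀) hs0)]
      ring
    have huu₀ : u₀ ≤ u := by
      rw [hu_def]
      calc u₀ = Real.sqrt (u₀ ^ 2) := (Real.sqrt_sq hu₀pos.le).symm
        _ ≤ Real.sqrt (s / 2) := Real.sqrt_le_sqrt hs0
    -- (4): `2u² ≤ m + u R ≤ m + u ρ`
    have h4' : 2 * u ^ 2 ≤ m + u * ρ := by
      have : s ≤ m + u * R := h4
      nlinarith [mul_le_mul_of_nonneg_left hRρ hu0]
    -- monotonicity of `t ↦ 2t² - ρ t` on `t ≥ u₀ ≥ ρ/4`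
    have hmono : u₀ * (2 * u₀ - ρ) ≤ 2 * u ^ 2 - u * ρ := by
      nlinarith [mul_nonneg (sub_nonneg.2 huu₀) (show 0 ≤ 2 * (u + u₀) - ρ by linarith)]
    show c ≤ (∑ x : TorusSite d (2 * (k + 1)), ∑ y : TorusSite d (2 * (k + 1)),
          (-1 : ℝ) ^ (∑ i, (x i).val) * (-1) ^ (∑ i, (y i).val) *
            groundStateSpinCorrTorus (2 * (k + 1)) n J x y) / ((2 * (k + 1) : ℕ) : ℝ) ^ (2 * d)
    rw [hsum, hc_def]
    linarith
  refine hc.trans_le (le_liminf_of_le ?_ hev)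
  exact isCoboundedUnder_ge_of_le atTop fun k => by
    haveI : NeZero (2 * k + 2) := ⟨by omega⟩
    exact neelSum_le (d := d) n (2 * k + 2) hJ

/-- `√2/2 < 2/√6` (the XY constant `1/√2` against the Néel threshold at spin `1`). [folklore] -/
theorem sqrt_two_div_two_lt_two_div_sqrt_six : Real.sqrt 2 / 2 < 2 / Real.sqrt 6 := by
  have h6 : (0 : ℝ) < Real.sqrt 6 := Real.sqrt_pos.2 (by norm_num)
  rw [div_lt_div_iff₀ two_pos h6, ← Real.sqrt_mul (by norm_num : (0 : ℝ) ≤ 2)]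
  have : Real.sqrt (2 * 6) < 4 := by
    rw [Real.sqrt_lt' (by norm_num)]
    norm_num
  linarith

/-- For spin `S ≥ 1` (`n ≥ 2`) the tree's bound on the Riemann sums suffices:
`R_L(d) ≤ 0.69 < 1/√2 < 2/√6 ≤ n/√6` eventually (`klsRiemannSum_eventually_le`).
[Kennedy–Lieb–Shastry 1988, p. 1020 ("the ground state of the two-dimensional Heisenberg
antiferromagnet has Néel order if the spin is at least 1")] [folklore] -/
theorem klsRiemannSum_eventually_le_neel (hd : 2 ≤ d) {n : ℕ} (hn : 2 ≤ n) :
    ∃ ρ : ℝ, ρ < n / Real.sqrt 6 ∧ ∀ᶠ L : ℕ in atTop, klsRiemannSum d L ≤ ρ := by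
  obtain ⟨ρ, hρ, hev⟩ := klsRiemannSum_eventually_le d hd
  refine ⟨ρ, ?_, hev⟩
  have h6 : (0 : ℝ) < Real.sqrt 6 := Real.sqrt_pos.2 (by norm_num)
  have hn2 : (2 : ℝ) ≤ n := by exact_mod_cast hn
  have h2 : 2 / Real.sqrt 6 ≤ n / Real.sqrt 6 := div_le_div_of_nonneg_right hn2 h6.le
  linarith [sqrt_two_div_two_lt_two_div_sqrt_six]

/-- **Kennedy–Lieb–Shastry / Dyson–Lieb–Simon from the infrared bound and the `d = 3` numerics.**
If the `T = 0` infrared bound (A) of Kennedy–Lieb–Shastry (J. Stat. Phys. 53 (1988), eq. (1), in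
the finite-volume form `0 ≤ ĝ_q`, `ĝ_q² E_{q-Q} ≤ (-ε/2) E_q` for `q ≠ Q` on the even tori
`(ℤ/2kℤ)^d`, `k ≥ 2`, `d ≥ 2`, all spins) holds, and the punctured Riemann sums of the KLS
integrand in `d = 3` satisfy `R_L(3) ≤ ρ < 1/√6` for all large `L` (KLS p. 1022:
`∫ = 0.0824·√18 = 0.35 < 0.408`), then `kennedy_lieb_shastry_ground` holds: `d = 3, S = ½` by the
numerical input, `d ∈ {2, 3}, S ≥ 1` by `limsup R_L(d) ≤ 0.69` (`klsRiemannSum_eventually_le`).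
[Kennedy–Lieb–Shastry 1988, Theorem (p. 1022) and p. 1020; Dyson–Lieb–Simon 1978]
[cite: KLS1988JSP, pp. 1020–1022] -/
theorem kennedy_lieb_shastry_ground_of_infraredBound
    (hA : ∀ (d : ℕ), 2 ≤ d → ∀ (n : ℕ), 1 ≤ n → ∀ (k : ℕ), 2 ≤ k →
      ∀ q : TorusSite d (2 * k), q ≠ neelIndex (2 * k) →
        0 ≤ heisStructureFactor 0 (2 * k) n q ∧
          heisStructureFactor 0 (2 * k) n q ^ 2 *
              dispersion (latticeMomentum (2 * k) (q - neelIndex (2 * k))) ≤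
            (-heisBondCorr (d := d) 0 (2 * k) n / 2) * dispersion (latticeMomentum (2 * k) q))
    (hR : ∃ ρ : ℝ, ρ < 1 / Real.sqrt 6 ∧ ∀ᶠ L : ℕ in atTop, klsRiemannSum 3 L ≤ ρ) :
    kennedy_lieb_shastry_ground := by
  intro d n h J hJ
  rcases h with ⟨rfl, hn⟩ | ⟨rfl, hn⟩
  · -- `d = 3`, `S ≥ ½`
    rcases Nat.lt_or_ge n 2 with hn1 | hn2
    · obtain rfl : n = 1 := by omega
      refine heis_neelOrder_of_infraredBound (by norm_num) le_rfl (hA 3 (by norm_num) 1 le_rfl)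
        ?_ hJ
      simpa using hR
    · exact heis_neelOrder_of_infraredBound (by norm_num) hn (hA 3 (by norm_num) n hn)
        (klsRiemannSum_eventually_le_neel (by norm_num) hn2) hJ
  · -- `d = 2`, `S ≥ 1`
    exact heis_neelOrder_of_infraredBound le_rfl (by omega) (hA 2 le_rfl n (by omega))
      (klsRiemannSum_eventually_le_neel le_rfl hn) hJ

end Literature.MathematicalPhysics.QuantumLattice
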